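import Summits.Ventures.PackingBounds.Energy.FivePointRieszEightGramDataY
import Summits.Ventures.PackingBounds.Energy.FivePointRieszEightXData
import Summits.Ventures.PackingBounds.Energy.FivePointRieszEightXDataP
import Summits.Ventures.PackingBounds.Energy.GramCongrCheck
import HarnessLib

/-!
# The congruence `X = P (S·Y) Pᵀ` of `e3pt-sharp-n3N5s8d8-none.json`: chunk file `CongrFacts2` (kernel evaluation on integer data)

Framing: lottery ticket; floor = certified bounds/negative ranges. Venture `PackingBounds`, cell
`pub-packcert`, energy family E3PT (pub-packcert-energy gen 15/17; n = 3, d = 8 kernel route = KERNEL-D6 double data route, size-split).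

`decide +kernel` checks `xR8_{ab} = Σ_i Σ_j bR8_{ai} yR8_{ij} bR8_{bj}` (`GramData.checkCongr` for row ranges, `GramData.checkCongrCols` for column
ranges of a dense row; zero entries of `bR8` skipped); collected in `FivePointRieszEightCongrFacts`.
-/

namespace Summit.Ventures.PackingBounds.Energy.RieszEightD8

open Summit.Ventures.PackingBounds.Energy.GramData

set_option maxRecDepth 100000 in
set_option maxHeartbeats 0 in
/-- Rows 33–43 of `X = P (S·Y) Pᵀ` (kernel evaluation). -/
theorem congrR8_33_44 : checkCongr 165 33 44 bR8 yR8 xR8 = true := by decide +kernel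

set_option maxRecDepth 100000 in
set_option maxHeartbeats 0 in
/-- Rows 44–54 of `X = P (S·Y) Pᵀ` (kernel evaluation). -/
theorem congrR8_44_55 : checkCongr 165 44 55 bR8 yR8 xR8 = true := by decide +kernel

set_option maxRecDepth 100000 in
set_option maxHeartbeats 0 in
/-- Rows 55–65 of `X = P (S·Y) Pᵀ` (kernel evaluation). -/
theorem congrR8_55_66 : checkCongr 165 55 66 bR8 yR8 xR8 = true := by decide +kernel

end Summit.Ventures.PackingBounds.Energy.RieszEightD8
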